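import Summits.QuantumAdvantage.QuantumAdvantage.Theorems.CubicForrelationNearExactIsExactFlatFrame
import Summits.QuantumAdvantage.QuantumAdvantage.Theorems.CubicForrelationNearExactIsExactFourteenSecondLevelSixBalanced

/-!
# Crux `CubicForrelation.NearExactIsExact` (stmt-QuantumAdvantage-14043) — infrastructure: the COSET → CUBE TRANSFER (relative Reed–Muller
  degree on a flat `c ⊕ V` becomes `IsDegLeFun` on the coordinate cube `𝔽₂^m` through a frame of `V`)

Certificate seat `b2b-cforr-cert` (gen 27 staged `ffd_card_transfer`; gen 28 completes the transfer).  HONEST FRAMING: bookkeeping lemmas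
(standard axioms) finishing PLAN-N12-WINDOW-O5.md §D; they let the tree's ABSOLUTE Reed–Muller / Kasami–Tokura bricks (`stub_rmWeight`,
`sw_quadratic_second_weight`, `sw_cubic_second_weight`, `kt3_weights_all`, `mw_flat_of_minweight`, all stated for `Fin m → Bool` with `IsDegLeFun`)
be applied to a Boolean function living on an abstract flat `c ⊕ V ⊂ 𝔽₂ⁿ` about which one only knows the flat-language form of "degree `≤ r`
along the flat": EVEN counts on every parametrised `(r+1)`-flat with base in the coset and directions in `V`.  NOT summit progress.

* `ffd_card_transfer`: with a full frame `φ : 𝔽₂^m → V` (…FlatFrame), `#{x ∈ c ⊕ V : h x} = #{θ : h(c ⊕ φ θ)}`.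
* `ffd_even_flat_mono`: even parametrised `(r+1)`-flat counts on a coset (directions in an xor-closed `S`) ⇒ even `k`-flat counts for all
  `k ≥ r+1` (split along the first direction, `erm_card_split` / `erm_flatPt_cons`).
* `ffd_even_flat_transfer`: even `(r+1)`-flat counts of `h` on `c ⊕ V` ⇒ even `(r+1)`-flat counts of `θ ↦ h(c ⊕ φ θ)` on the whole cube
  (`ffr_flat_transport`).
* `ffd_isDegLeFun_of_even_flats`: on the cube `𝔽₂^m`, even `(r+1)`-flat counts for all bases and directions ⇒ `IsDegLeFun r`
  (coordinate cubes are parametrised flats, `fo_sum_cube_eq_flat`; binary Möbius inversion, `bb_moebius_isDegLeFun`).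
* `ffd_isDegLeFun_transfer`, `ffd_transfer`: the packaged transfer — for `V ∋ 0` xor-closed with `#V = 2^m` and `h` of relative degree `≤ r`
  on `c ⊕ V` there is `ψ : 𝔽₂^m → 𝔽₂` with `IsDegLeFun r ψ` and `#{x ∈ c ⊕ V : h x} = #{θ : ψ θ}` (and `ψ θ = h (c ⊕ φ θ)` for an additive
  bijection `φ : 𝔽₂^m → V`).

References: F. J. MacWilliams, N. J. A. Sloane, *The Theory of Error-Correcting Codes* (1977), Ch. 13 §2–§3 (ANF; RM codes and their restrictions
to flats); C. Carlet, *Boolean Functions for Cryptography and Coding Theory*, CUP 2021, §2.2.  Everything below is proved from Mathlib and the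
tree; axioms are the standard three.
-/

set_option linter.dupNamespace false -- D-0017: single-problem summit ⇒ `QuantumAdvantage.QuantumAdvantage` by design

noncomputable section

namespace Summit.QuantumAdvantage.QuantumAdvantage.Theorems.CubicForrelation.NearExactIsExact

open Finset
open Literature.Computability.QuantumComplexity
open Literature.Computability.QuantumComplexity.BuzetChailloux (bxor zeroVec bxor_bxor_cancel_left bxor_zeroVec zeroVec_bxor bxor_comm
  bxor_self)

variable {n : ℕ}

/-! ### Counting through a frame -/

/-- **Counting through a frame**: for an injective parametrisation `φ` of `V` by `𝔽₂^m` that is onto `V`, the points of the coset `c ⊕ V` where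
`ψ` holds are counted by the parameters. [folklore] -/
theorem ffd_card_transfer {m : ℕ} (V : Finset (Fin n → Bool)) (b : Fin m → Fin n → Bool)
    (hinj : Function.Injective (fun θ : Fin m → Bool => (fun j => zeroVec j ^^ decide (Odd #(univ.filter fun i => θ i && b i j)))))
    (hsurj : ∀ v ∈ V, ∃ θ : Fin m → Bool, (fun j => zeroVec j ^^ decide (Odd #(univ.filter fun i => θ i && b i j))) = v)
    (hbV : ∀ θ : Fin m → Bool, (fun j => zeroVec j ^^ decide (Odd #(univ.filter fun i => θ i && b i j))) ∈ V)
    (c : Fin n → Bool) (ψ : (Fin n → Bool) → Bool) :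
    #((V.image (bxor c)).filter fun x => ψ x = true) =
      #(univ.filter fun θ : Fin m → Bool => ψ (bxor c (fun j => zeroVec j ^^ decide (Odd #(univ.filter fun i => θ i && b i j)))) = true) := by
  classical
  set Φ : (Fin m → Bool) → (Fin n → Bool) := fun θ => bxor c (fun j => zeroVec j ^^ decide (Odd #(univ.filter fun i => θ i && b i j))) with hΦ
  have hΦinj : Function.Injective Φ := by
    intro θ θ' h
    apply hinj
    have h' := congrArg (bxor c) h
    simp only [Φ, bxor_bxor_cancel_left] at h'
    exact h'
  have hEq : ((V.image (bxor c)).filter fun x => ψ x = true) = (univ.filter fun θ : Fin m → Bool => ψ (Φ θ) = true).image Φ := by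
    ext x
    simp only [mem_filter, mem_image, mem_univ, true_and]
    constructor
    · rintro ⟨⟨v, hv, rfl⟩, hψ⟩
      obtain ⟨θ, hθ⟩ := hsurj v hv
      refine ⟨θ, ?_, ?_⟩
      · simp only [Φ]; rw [hθ]; exact hψ
      · simp only [Φ]; rw [hθ]
    · rintro ⟨θ, hψ, rfl⟩
      exact ⟨⟨_, hbV θ, rfl⟩, hψ⟩
  rw [hEq, card_image_of_injective _ hΦinj]

/-! ### Even flat counts go up in dimension -/

/-- Translating the base commutes with the parametrisation: `c ⊕ (x ⊕ ⊕_ε aᵢ) = (c ⊕ x) ⊕ ⊕_ε aᵢ`. [folklore] -/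
theorem ffd_bxor_flatPt {k : ℕ} (c x : Fin n → Bool) (a : Fin k → Fin n → Bool) (ε : Fin k → Bool) :
    bxor c (fun j => x j ^^ decide (Odd #(univ.filter fun i => ε i && a i j))) =
      fun j => (bxor c x) j ^^ decide (Odd #(univ.filter fun i => ε i && a i j)) := by
  funext j
  simp only [bxor, Bool.xor_assoc]

/-- **Even counts propagate upward.**  If `h` has an even number of ones (counted over the parameters) on every parametrised `(r+1)`-flat
with base in the coset `c ⊕ S` and directions in the xor-closed set `S`, then the same holds for every parametrised `k`-flat, `k ≥ r + 1`:
a `(k+1)`-flat is the disjoint union of the `k`-flat spanned by the last `k` directions and its translate by the first one.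
[cite: MacWilliamsSloane1977, Ch. 13 §3] -/
theorem ffd_even_flat_mono (S : Finset (Fin n → Bool)) (hadd : ∀ x ∈ S, ∀ y ∈ S, bxor x y ∈ S) (c : Fin n → Bool)
    (h : (Fin n → Bool) → Bool) (r : ℕ)
    (hflat : ∀ b ∈ S.image (bxor c), ∀ a : Fin (r + 1) → Fin n → Bool, (∀ i, a i ∈ S) →
      Even #(univ.filter fun ε : Fin (r + 1) → Bool =>
        h (fun j => b j ^^ decide (Odd #(univ.filter fun i => ε i && a i j))) = true)) :
    ∀ k, r + 1 ≤ k → ∀ b ∈ S.image (bxor c), ∀ a : Fin k → Fin n → Bool, (∀ i, a i ∈ S) →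
      Even #(univ.filter fun ε : Fin k → Bool =>
        h (fun j => b j ^^ decide (Odd #(univ.filter fun i => ε i && a i j))) = true) := by
  classical
  intro k hk
  induction k, hk using Nat.le_induction with
  | base => exact hflat
  | succ k hk ih =>
    intro b hb a ha
    have ea : a = Fin.cons (a 0) (Fin.tail a) := (Fin.cons_self_tail a).symm
    rw [erm_card_split]
    -- the two halves: parameter `ε 0 = false` (the `k`-flat at `b`) and `ε 0 = true` (its translate by `a 0`)
    have hfalse : (univ.filter fun ε : Fin k → Bool =>
        h (fun j => b j ^^ decide (Odd #(univ.filter fun i => (Fin.cons false ε : Fin (k + 1) → Bool) i && a i j))) = true) =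
        univ.filter fun ε : Fin k → Bool =>
          h (fun j => b j ^^ decide (Odd #(univ.filter fun i => ε i && Fin.tail a i j))) = true := by
      refine filter_congr fun ε _ => ?_
      conv_lhs => rw [ea, erm_flatPt_cons]
      simp only [Bool.false_and, Bool.xor_false, Fin.tail]
    have htrue : (univ.filter fun ε : Fin k → Bool =>
        h (fun j => b j ^^ decide (Odd #(univ.filter fun i => (Fin.cons true ε : Fin (k + 1) → Bool) i && a i j))) = true) =
        univ.filter fun ε : Fin k → Bool =>
          h (fun j => (bxor b (a 0)) j ^^ decide (Odd #(univ.filter fun i => ε i && Fin.tail a i j))) = true := by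
      refine filter_congr fun ε _ => ?_
      conv_lhs => rw [ea, erm_flatPt_cons]
      simp only [Bool.true_and, Fin.tail, bxor]
      have e : (fun j => (b j ^^ decide (Odd #(univ.filter fun i : Fin k => ε i && a i.succ j))) ^^ a 0 j) =
          fun j => (b j ^^ a 0 j) ^^ decide (Odd #(univ.filter fun i : Fin k => ε i && a i.succ j)) := by
        funext j
        cases b j <;> cases a 0 j <;> cases decide (Odd #(univ.filter fun i : Fin k => ε i && a i.succ j)) <;> rfl
      rw [e]
    rw [hfalse, htrue]
    refine Even.add (ih b hb (Fin.tail a) fun i => ha _) (ih (bxor b (a 0)) ?_ (Fin.tail a) fun i => ha _)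
    obtain ⟨s, hs, rfl⟩ := mem_image.1 hb
    exact mem_image.2 ⟨bxor s (a 0), hadd s hs (a 0) (ha 0), by rw [iw_bxor_assoc]⟩

/-! ### Transport of even flat counts through a frame -/

/-- **Transport through a frame.**  If `h` has even parametrised `(r+1)`-flat counts on the coset `c ⊕ V` (directions in `V`) and
`φ : θ ↦ ⊕_{θᵢ} bᵢ` takes values in `V`, then `θ ↦ h (c ⊕ φ θ)` has even parametrised `(r+1)`-flat counts on the whole cube `𝔽₂^m`
(every base, every direction): the `φ`-image of a cube flat is a coset flat (`ffr_flat_transport`). [folklore] -/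
theorem ffd_even_flat_transfer {m r : ℕ} (V : Finset (Fin n → Bool)) (b : Fin m → Fin n → Bool)
    (hbV : ∀ θ : Fin m → Bool, (fun j => zeroVec j ^^ decide (Odd #(univ.filter fun i => θ i && b i j))) ∈ V)
    (c : Fin n → Bool) (h : (Fin n → Bool) → Bool)
    (hflat : ∀ x ∈ V.image (bxor c), ∀ a : Fin (r + 1) → Fin n → Bool, (∀ i, a i ∈ V) →
      Even #(univ.filter fun ε : Fin (r + 1) → Bool =>
        h (fun j => x j ^^ decide (Odd #(univ.filter fun i => ε i && a i j))) = true)) :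
    ∀ (θ₀ : Fin m → Bool) (α : Fin (r + 1) → Fin m → Bool),
      Even #(univ.filter fun ε : Fin (r + 1) → Bool =>
        h (bxor c (fun j => zeroVec j ^^ decide (Odd #(univ.filter fun i =>
          (fun i => θ₀ i ^^ decide (Odd #(univ.filter fun l => ε l && α l i))) i && b i j)))) = true) := by
  classical
  intro θ₀ α
  have key := hflat (bxor c (fun j => zeroVec j ^^ decide (Odd #(univ.filter fun i => θ₀ i && b i j))))
    (mem_image.2 ⟨_, hbV θ₀, rfl⟩)
    (fun l => (fun j => zeroVec j ^^ decide (Odd #(univ.filter fun i => α l i && b i j)))) (fun l => hbV (α l))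
  have harg : ∀ ε : Fin (r + 1) → Bool,
      bxor c (fun j => zeroVec j ^^ decide (Odd #(univ.filter fun i =>
          (fun i => θ₀ i ^^ decide (Odd #(univ.filter fun l => ε l && α l i))) i && b i j))) =
        fun j => (bxor c (fun j => zeroVec j ^^ decide (Odd #(univ.filter fun i => θ₀ i && b i j)))) j ^^
          decide (Odd #(univ.filter fun l => ε l &&
            (fun l => (fun j => zeroVec j ^^ decide (Odd #(univ.filter fun i => α l i && b i j)))) l j)) := by
    intro ε
    rw [← ffr_flat_transport b θ₀ α ε]
    funext j
    simp only [bxor, Bool.xor_assoc]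
  have hset : (univ.filter fun ε : Fin (r + 1) → Bool =>
      h (bxor c (fun j => zeroVec j ^^ decide (Odd #(univ.filter fun i =>
        (fun i => θ₀ i ^^ decide (Odd #(univ.filter fun l => ε l && α l i))) i && b i j)))) = true) =
      univ.filter fun ε : Fin (r + 1) → Bool =>
        h (fun j => (bxor c (fun j => zeroVec j ^^ decide (Odd #(univ.filter fun i => θ₀ i && b i j)))) j ^^
          decide (Odd #(univ.filter fun l => ε l &&
            (fun l => (fun j => zeroVec j ^^ decide (Odd #(univ.filter fun i => α l i && b i j)))) l j))) = true := by
    refine filter_congr fun ε _ => ?_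
    rw [harg ε]
  rw [hset]
  exact key

/-! ### The cube: even flat counts everywhere ⇒ bounded degree -/

/-- **Even `(r+1)`-flat counts on the cube give degree `≤ r`.**  If `ψ : 𝔽₂^m → 𝔽₂` has an even number of ones (over the parameters) on
every parametrised `(r+1)`-flat (every base, every choice of directions), then `IsDegLeFun r ψ`: by `ffd_even_flat_mono` the counts on all
`k`-flats, `k > r`, are even, in particular on the coordinate cubes `E_I = {u : supp u ⊆ I}`, `#I > r` (`fo_sum_cube_eq_flat`), and binary Möbius
inversion (`bb_moebius_isDegLeFun`) concludes. [cite: MacWilliamsSloane1977, Ch. 13 §2–§3] -/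
theorem ffd_isDegLeFun_of_even_flats {m r : ℕ} (ψ : (Fin m → Bool) → Bool)
    (hflat : ∀ (x : Fin m → Bool) (a : Fin (r + 1) → Fin m → Bool),
      Even #(univ.filter fun ε : Fin (r + 1) → Bool =>
        ψ (fun j => x j ^^ decide (Odd #(univ.filter fun i => ε i && a i j))) = true)) :
    IsDegLeFun r ψ := by
  classical
  -- even counts on all `k`-flats, `k ≥ r + 1` (take `S = univ`, `c = 0`)
  have hall := ffd_even_flat_mono (univ : Finset (Fin m → Bool)) (fun x _ y _ => mem_univ _) zeroVec ψ r
    (fun x _ a _ => hflat x a)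
  refine bb_moebius_isDegLeFun r ψ fun I hI => ?_
  have hk := hall #I (by omega) zeroVec (mem_image.2 ⟨zeroVec, mem_univ _, bxor_zeroVec _⟩)
    (fun i : Fin #I => (Pi.single (I.orderEmbOfFin rfl i) true : Fin m → Bool)) (fun _ => mem_univ _)
  -- the cube count is the flat count
  have hcube := fo_sum_cube_eq_flat (fun x => if ψ x = true then (1 : ℤ) else 0) I
  rw [sum_boole, sum_boole] at hcube
  have hc : #{u : Fin m → Bool | (∀ i, u i = true → i ∈ I) ∧ ψ u = true} =
      #((univ.filter fun x : Fin m → Bool => ∀ i, x i = true → i ∈ I).filter fun x => ψ x = true) := by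
    rw [filter_filter]
  rw [hc]
  have hz : ((#((univ.filter fun x : Fin m → Bool => ∀ i, x i = true → i ∈ I).filter fun x => ψ x = true) : ℕ) : ℤ) =
      ((#(univ.filter fun ε : Fin #I → Bool => ψ (fun j => (zeroVec : Fin m → Bool) j ^^ decide (Odd #(univ.filter fun i : Fin #I =>
        ε i && (fun i : Fin #I => (Pi.single (I.orderEmbOfFin rfl i) true : Fin m → Bool)) i j))) = true) : ℕ) : ℤ) := by
    exact_mod_cast hcube
  rw [Int.natCast_inj.mp hz]
  exact hk

/-! ### The packaged transfer -/

/-- **Coset → cube transfer of the degree.**  If `h` has even parametrised `(r+1)`-flat counts on the coset `c ⊕ V` (directions in `V`) and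
`φ : 𝔽₂^m → V` is a parametrisation `θ ↦ ⊕_{θᵢ} bᵢ` with values in `V`, then `θ ↦ h (c ⊕ φ θ)` has algebraic degree `≤ r`.
[cite: MacWilliamsSloane1977, Ch. 13 §3] -/
theorem ffd_isDegLeFun_transfer {m r : ℕ} (V : Finset (Fin n → Bool)) (b : Fin m → Fin n → Bool)
    (hbV : ∀ θ : Fin m → Bool, (fun j => zeroVec j ^^ decide (Odd #(univ.filter fun i => θ i && b i j))) ∈ V)
    (c : Fin n → Bool) (h : (Fin n → Bool) → Bool)
    (hflat : ∀ x ∈ V.image (bxor c), ∀ a : Fin (r + 1) → Fin n → Bool, (∀ i, a i ∈ V) →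
      Even #(univ.filter fun ε : Fin (r + 1) → Bool =>
        h (fun j => x j ^^ decide (Odd #(univ.filter fun i => ε i && a i j))) = true)) :
    IsDegLeFun r (fun θ : Fin m → Bool => h (bxor c (fun j => zeroVec j ^^ decide (Odd #(univ.filter fun i => θ i && b i j))))) :=
  ffd_isDegLeFun_of_even_flats _ (ffd_even_flat_transfer V b hbV c h hflat)

/-- Frame vectors of `V` parametrise points of `V` (`V ∋ 0` xor-closed). [folklore] -/
theorem ffd_flatPt_mem {m : ℕ} (V : Finset (Fin n → Bool)) (h0 : zeroVec ∈ V) (hadd : ∀ x ∈ V, ∀ y ∈ V, bxor x y ∈ V)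
    (b : Fin m → Fin n → Bool) (hb : ∀ i, b i ∈ V) (θ : Fin m → Bool) :
    (fun j => zeroVec j ^^ decide (Odd #(univ.filter fun i => θ i && b i j))) ∈ V :=
  ws_flatPt_mem V h0 (· ∈ V) (fun z hz a ha => hadd z hz a ha) m zeroVec h0 b hb θ

/-- **THE TRANSFER (packaged).**  Let `V ∋ 0` be xor-closed with `#V = 2^m`, `c` any point, and `h` a Boolean function with an even number of
ones on every parametrised `(r+1)`-flat with base in `c ⊕ V` and directions in `V` ("relative degree `≤ r` on the flat `c ⊕ V`").  Then there
is `ψ : 𝔽₂^m → 𝔽₂` of algebraic degree `≤ r` with the same number of ones: `#{x ∈ c ⊕ V : h x} = #{θ : ψ θ}`.  Concretely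
`ψ θ = h (c ⊕ φ θ)` for an additive bijection `φ : 𝔽₂^m → V` (a frame, `ffr_frame`).  Every absolute weight statement about `RM(r,m)`
in the tree thereby holds verbatim on abstract `m`-flats. [cite: MacWilliamsSloane1977, Ch. 13 §3] -/
theorem ffd_transfer {m r : ℕ} (V : Finset (Fin n → Bool)) (h0 : zeroVec ∈ V) (hadd : ∀ x ∈ V, ∀ y ∈ V, bxor x y ∈ V)
    (hcard : #V = 2 ^ m) (c : Fin n → Bool) (h : (Fin n → Bool) → Bool)
    (hflat : ∀ x ∈ V.image (bxor c), ∀ a : Fin (r + 1) → Fin n → Bool, (∀ i, a i ∈ V) →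
      Even #(univ.filter fun ε : Fin (r + 1) → Bool =>
        h (fun j => x j ^^ decide (Odd #(univ.filter fun i => ε i && a i j))) = true)) :
    ∃ b : Fin m → Fin n → Bool, (∀ i, b i ∈ V) ∧
      Function.Injective (fun θ : Fin m → Bool => (fun j => zeroVec j ^^ decide (Odd #(univ.filter fun i => θ i && b i j)))) ∧
      (∀ v ∈ V, ∃ θ : Fin m → Bool, (fun j => zeroVec j ^^ decide (Odd #(univ.filter fun i => θ i && b i j))) = v) ∧
      IsDegLeFun r (fun θ : Fin m → Bool => h (bxor c (fun j => zeroVec j ^^ decide (Odd #(univ.filter fun i => θ i && b i j))))) ∧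
      #((V.image (bxor c)).filter fun x => h x = true) =
        #(univ.filter fun θ : Fin m → Bool =>
          h (bxor c (fun j => zeroVec j ^^ decide (Odd #(univ.filter fun i => θ i && b i j)))) = true) := by
  obtain ⟨b, hbV, hinj, hsurj⟩ := ffr_frame V h0 hadd hcard
  have hmem := ffd_flatPt_mem V h0 hadd b hbV
  exact ⟨b, hbV, hinj, hsurj, ffd_isDegLeFun_transfer V b hmem c h hflat, ffd_card_transfer V b hinj hsurj hmem c h⟩

/-- **Weight form of the transfer** (the shape the relative bricks consume): under the hypotheses of `ffd_transfer` there is a degree-`≤ r`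
function `ψ` on `m` bits with `#{x ∈ c ⊕ V : h x} = #{θ : ψ θ}`. [cite: MacWilliamsSloane1977, Ch. 13 §3] -/
theorem ffd_transfer_weight {m r : ℕ} (V : Finset (Fin n → Bool)) (h0 : zeroVec ∈ V) (hadd : ∀ x ∈ V, ∀ y ∈ V, bxor x y ∈ V)
    (hcard : #V = 2 ^ m) (c : Fin n → Bool) (h : (Fin n → Bool) → Bool)
    (hflat : ∀ x ∈ V.image (bxor c), ∀ a : Fin (r + 1) → Fin n → Bool, (∀ i, a i ∈ V) →
      Even #(univ.filter fun ε : Fin (r + 1) → Bool =>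
        h (fun j => x j ^^ decide (Odd #(univ.filter fun i => ε i && a i j))) = true)) :
    ∃ ψ : (Fin m → Bool) → Bool, IsDegLeFun r ψ ∧ #((V.image (bxor c)).filter fun x => h x = true) = #(univ.filter fun θ => ψ θ = true) := by
  obtain ⟨b, -, -, -, hdeg, hcount⟩ := ffd_transfer V h0 hadd hcard c h hflat
  exact ⟨_, hdeg, hcount⟩

end Summit.QuantumAdvantage.QuantumAdvantage.Theorems.CubicForrelation.NearExactIsExact

end
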